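import Mathlib
import Summits.ResolutionOfSingularities.ResolutionOfSingularities.Theorems.ShadowGameWinR.Negative.MirrorR
import Summits.ResolutionOfSingularities.ResolutionOfSingularities.Theorems.ShadowGameWinR.Negative.CertInit
import Summits.ResolutionOfSingularities.ResolutionOfSingularities.Theorems.ShadowGameWinR.Negative.CertShear
import Summits.ResolutionOfSingularities.ResolutionOfSingularities.Theorems.ShadowGameShadowGameWinRStubDeriv
import Summits.ResolutionOfSingularities.ResolutionOfSingularities.Theorems.ShadowGameShadowGameWinRStubStructure
import Summits.ResolutionOfSingularities.ResolutionOfSingularities.Theorems.ShadowGameShadowGameWinRStubPsiPrime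

/-!
# `ShadowGameWinR` (crux stmt-ResolutionOfSingularities-18182, route `ShadowGame`), negative side —
# part 3c: the weighted initial form of the sheared surface and the core contradiction

Weights `wtS a e b = (2, b+2a+4e+6, 2a+4e+4)`; `init_form_PiSt`: `ι (θ Π(a,e,b,U)) = x^μ · ψ`,
`ψ = c·x^{a+2e−μ} y² − x^{b−μ} z³`, `μ = min (a+2e) b`, `c = (θ U)(0) ≠ 0`;
`no_monomial_decomposition`: a position `x · Π^p · E^p` is never `w^A · v + g^p` with `w` of invertible
linear part, `v` a unit and some `p ∤ A k` — `stub_structure` puts `M · ŵ_k` in `J(f) ⊆ (Π^p)`, then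
`ι ∘ θ` and the primality of `ψ` (`stub_psiPrime`) force `ψ ∣ ι (θ w_j)` for an order-one `w_j`, whose
initial form has weight `≤ wt_y < weight ψ`.
Lead prover-line-stmt-ResolutionOfSingularities-18182-0, 2026-08-17.
-/

noncomputable section

set_option linter.dupNamespace false

namespace Summit.ResolutionOfSingularities.ResolutionOfSingularities.Theorems.ShadowGameWinR.Negative

open MvPowerSeries

variable {κ : Type} [Field κ]

section Core

variable (κ)

/-- The weights used for the position `(a,e,b)`: `wt_x = 2`, `wt_z = 2(a+2e+2)`, `wt_y = b+2a+4e+6`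
(so that `x^{a+2e} y²` and `x^b z³` have the same weight and `wt_z > wt_x`). [folklore] -/
def wtS (a e b : ℕ) : Fin 3 → ℕ := ![2, b + 2 * a + 4 * e + 6, 2 * a + 4 * e + 4]

/-- All weights are positive. [folklore] -/
theorem wtS_pos (a e b : ℕ) : ∀ i, 0 < wtS a e b i := by
  intro i; fin_cases i <;> simp [wtS]

/-- Values of the weights. [folklore] -/
theorem wtS_val (a e b : ℕ) : wtS a e b 0 = 2 ∧ wtS a e b 1 = b + 2 * a + 4 * e + 6 ∧
    wtS a e b 2 = 2 * a + 4 * e + 4 := ⟨rfl, rfl, rfl⟩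

variable {κ}

/-- With the weights `wtS`, an exponent of weight `2` is `x¹`. [folklore] -/
theorem eq_single_of_weight_two {a e b : ℕ} {d : Fin 3 →₀ ℕ} (hd : Finsupp.weight (wtS a e b) d = 2) :
    d = Finsupp.single 0 1 := by
  rw [weight_eq_sum, Fin.sum_univ_three] at hd
  simp only [wtS, Matrix.cons_val_zero, Matrix.cons_val_one, Matrix.cons_val] at hd
  have h1 : d 1 = 0 := by
    by_contra hne
    have : 1 ≤ d 1 := Nat.one_le_iff_ne_zero.mpr hne
    nlinarith
  have h2 : d 2 = 0 := by
    by_contra hne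
    have : 1 ≤ d 2 := Nat.one_le_iff_ne_zero.mpr hne
    nlinarith
  have h0 : d 0 = 1 := by rw [h1, h2] at hd; omega
  ext j
  fin_cases j <;> simp [h0, h1, h2]

/-- `ι (z + φ) = x` for the weights `wtS` (the shear tilts `z` down to weight `wt_x`). [folklore] -/
theorem IsInit.of_X2_add_phi {a e b : ℕ} {ι : MvPowerSeries (Fin 3) κ → MvPolynomial (Fin 3) κ}
    (hι : IsInit (wtS a e b) ι) : ι (X 2 + phiS κ) = MvPolynomial.X 0 := by
  classical
  have hlin : MvPowerSeries.coeff (Finsupp.single 0 1) (X 2 + phiS κ : MvPowerSeries (Fin 3) κ) = 1 := by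
    rw [map_add, coeff_single_zero_phi, MvPowerSeries.coeff_X, if_neg (by
      intro h; have := congrArg (fun f => f 0) h; simp at this), zero_add]
  have key := hι.coeff_of_level (f := X 2 + phiS κ) (N := 2)
    (fun d hd => by
      have hd0 : d = 0 := by
        by_contra hne
        obtain ⟨i, hi⟩ : ∃ i, d i ≠ 0 := by
          by_contra! h; exact hne (Finsupp.ext h)
        have h1 := mul_le_weight (wtS a e b) d i
        have h2 := wtS_pos a e b i
        have h3 : 2 ≤ wtS a e b i := by fin_cases i <;> simp [wtS]
        have : 1 ≤ d i := Nat.one_le_iff_ne_zero.mpr hi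
        nlinarith
      subst hd0
      rw [MvPowerSeries.coeff_zero_eq_constantCoeff_apply, map_add, constantCoeff_phi,
        MvPowerSeries.constantCoeff_X, add_zero])
    ⟨Finsupp.single 0 1, by simp [Finsupp.weight_single, wtS], by rw [hlin]; exact one_ne_zero⟩
  ext d
  rw [key d, MvPolynomial.coeff_X]
  by_cases h : Finsupp.weight (wtS a e b) d = 2
  · rw [if_pos h, eq_single_of_weight_two h, hlin, if_pos rfl]
  · rw [if_neg h, if_neg]
    rintro rfl
    exact h (by simp [Finsupp.weight_single, wtS])

/-- Support of the edge binomial: coefficients of `C c · x^α y² − x^β z³`. [folklore] -/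
theorem coeff_psi (c : κ) (α β : ℕ) (d : Fin 3 →₀ ℕ) :
    MvPolynomial.coeff d (MvPolynomial.C c * MvPolynomial.X 0 ^ α * MvPolynomial.X 1 ^ 2 -
      MvPolynomial.X 0 ^ β * MvPolynomial.X 2 ^ 3 : MvPolynomial (Fin 3) κ) =
      (if d = Finsupp.single 0 α + Finsupp.single 1 2 then c else 0) -
      (if d = Finsupp.single 0 β + Finsupp.single 2 3 then 1 else 0) := by
  classical
  have h1 : (MvPolynomial.C c * MvPolynomial.X 0 ^ α * MvPolynomial.X 1 ^ 2 : MvPolynomial (Fin 3) κ) =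
      MvPolynomial.monomial (Finsupp.single 0 α + Finsupp.single 1 2) c := by
    rw [MvPolynomial.X_pow_eq_monomial, MvPolynomial.X_pow_eq_monomial, MvPolynomial.C_mul_monomial,
      MvPolynomial.monomial_mul, mul_one, mul_one]
  have h2 : (MvPolynomial.X 0 ^ β * MvPolynomial.X 2 ^ 3 : MvPolynomial (Fin 3) κ) =
      MvPolynomial.monomial (Finsupp.single 0 β + Finsupp.single 2 3) 1 := by
    rw [MvPolynomial.X_pow_eq_monomial, MvPolynomial.X_pow_eq_monomial, MvPolynomial.monomial_mul, mul_one]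
  rw [h1, h2, MvPolynomial.coeff_sub, MvPolynomial.coeff_monomial, MvPolynomial.coeff_monomial]
  congr 1 <;> simp only [eq_comm]

/-- **Initial form of the sheared surface**: with the weights `wtS a e b`,
`ι (θ Π(a,e,b,U)) = x^μ · (c·x^{a+2e−μ} y² − x^{b−μ} z³)`, `μ = min (a+2e) b`, `c = (θ U)(0) ≠ 0`. [folklore] -/
theorem init_form_PiSt (a e b : ℕ) (U : MvPowerSeries (Fin 3) κ) (hU : IsUnit U)
    {ι : MvPowerSeries (Fin 3) κ → MvPolynomial (Fin 3) κ} (hι : IsInit (wtS a e b) ι) :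
    ι (MvPowerSeries.subst (shUp κ) (PiSt a e b U)) =
      MvPolynomial.X 0 ^ (min (a + 2 * e) b) *
        (MvPolynomial.C (MvPowerSeries.constantCoeff (MvPowerSeries.subst (shUp κ) U)) *
          MvPolynomial.X 0 ^ (a + 2 * e - min (a + 2 * e) b) * MvPolynomial.X 1 ^ 2 -
        MvPolynomial.X 0 ^ (b - min (a + 2 * e) b) * MvPolynomial.X 2 ^ 3) := by
  classical
  set θ : MvPowerSeries (Fin 3) κ →ₐ[κ] MvPowerSeries (Fin 3) κ := MvPowerSeries.substAlgHom (hasSubst_up κ)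
    with hθ
  have hθap : ∀ x, θ x = MvPowerSeries.subst (shUp κ) x := fun x => MvPowerSeries.substAlgHom_apply _ x
  set cU : κ := MvPowerSeries.constantCoeff (MvPowerSeries.subst (shUp κ) U) with hcU
  have hcU0 : cU ≠ 0 := by
    rw [hcU, ← hθap]; exact (MvPowerSeries.isUnit_iff_constantCoeff.mp (hU.map θ)).ne_zero
  set μ := min (a + 2 * e) b with hμ
  -- θ Π = P1 - P2
  have hthPi : MvPowerSeries.subst (shUp κ) (PiSt a e b U) =
      X 0 ^ a * (X 2 + phiS κ) ^ (2 * e) * MvPowerSeries.subst (shUp κ) U * X 1 ^ 2 -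
        X 0 ^ b * ((1 - X 0) * X 2) ^ 3 := by
    have hin : (X 2 + phiS κ - X 0 - X 0 * (X 2 + phiS κ) : MvPowerSeries (Fin 3) κ) = (1 - X 0) * X 2 := by
      have h := one_sub_X_mul_phi κ
      linear_combination h
    unfold PiSt Wp
    simp only [MvPowerSeries.subst_sub (hasSubst_up κ), MvPowerSeries.subst_mul (hasSubst_up κ),
      MvPowerSeries.subst_pow (hasSubst_up κ), subst_up_X0, subst_up_X1, subst_up_X2, hin]
  set P1 : MvPowerSeries (Fin 3) κ :=
    X 0 ^ a * (X 2 + phiS κ) ^ (2 * e) * MvPowerSeries.subst (shUp κ) U * X 1 ^ 2 with hP1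
  set P2 : MvPowerSeries (Fin 3) κ := X 0 ^ b * ((1 - X 0) * X 2) ^ 3 with hP2
  -- initial forms of the two parts
  have hιP1 : ι P1 = MvPolynomial.monomial (Finsupp.single 0 (a + 2 * e) + Finsupp.single 1 2) cU := by
    rw [hP1, hι.mul, hι.mul, hι.mul, hι.pow, hι.pow, hι.pow, hι.of_X, hι.of_X, hι.of_X2_add_phi,
      hι.of_unit (wtS_pos a e b) (u := MvPowerSeries.subst (shUp κ) U) (by rw [← hcU]; exact hcU0),
      ← hcU, MvPolynomial.monomial_eq, Finsupp.prod_add_index' (by simp) (by simp [pow_add]),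
      Finsupp.prod_single_index (by simp), Finsupp.prod_single_index (by simp)]
    ring
  have hιP2 : ι P2 = MvPolynomial.monomial (Finsupp.single 0 b + Finsupp.single 2 3) 1 := by
    have h1 : MvPowerSeries.constantCoeff ((1 : MvPowerSeries (Fin 3) κ) - X 0) ≠ 0 := by simp
    rw [hP2, hι.mul, hι.pow, hι.pow, hι.mul, hι.of_X, hι.of_X, hι.of_unit (wtS_pos a e b) h1,
      MvPolynomial.monomial_eq, Finsupp.prod_add_index' (by simp) (by simp [pow_add]),
      Finsupp.prod_single_index (by simp), Finsupp.prod_single_index (by simp)]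
    simp
  -- both at the same level N
  set N : ℕ := 2 * b + 3 * wtS a e b 2 with hN
  have hP1ne : P1 ≠ 0 := by
    intro h0; have := congrArg ι h0
    rw [hιP1, (hι.zero_iff 0).mpr rfl, MvPolynomial.monomial_eq_zero] at this; exact hcU0 this
  have hP2ne : P2 ≠ 0 := by
    intro h0; have := congrArg ι h0
    rw [hιP2, (hι.zero_iff 0).mpr rfl, MvPolynomial.monomial_eq_zero] at this; exact one_ne_zero this
  have hw1 : Finsupp.weight (wtS a e b) (Finsupp.single 0 (a + 2 * e) + Finsupp.single 1 2) = N := by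
    rw [weight_eq_sum, Fin.sum_univ_three, hN]; simp [wtS]; ring
  have hw2 : Finsupp.weight (wtS a e b) (Finsupp.single 0 b + Finsupp.single 2 3) = N := by
    rw [weight_eq_sum, Fin.sum_univ_three, hN]; simp [wtS]; ring
  obtain ⟨hA1, hA2⟩ := hι.level_of_coeff_ne hP1ne (d := Finsupp.single 0 (a + 2 * e) + Finsupp.single 1 2)
    (by rw [hιP1, MvPolynomial.coeff_monomial, if_pos rfl]; exact hcU0)
  obtain ⟨hB1, hB2⟩ := hι.level_of_coeff_ne hP2ne (d := Finsupp.single 0 b + Finsupp.single 2 3)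
    (by rw [hιP2, MvPolynomial.coeff_monomial, if_pos rfl]; exact one_ne_zero)
  rw [hw1] at hA1 hA2; rw [hw2] at hB1 hB2
  have hne : ι P1 - ι P2 ≠ 0 := by
    intro h0
    have := congrArg (MvPolynomial.coeff (Finsupp.single 0 b + Finsupp.single 2 3)) h0
    rw [MvPolynomial.coeff_sub, hιP1, hιP2, MvPolynomial.coeff_monomial, MvPolynomial.coeff_monomial,
      if_neg, if_pos rfl, MvPolynomial.coeff_zero] at this
    · simp at this
    · intro heq
      have := congrArg (fun f => f 1) heq; simp at this
  rw [hthPi, hι.of_sub hA1 hA2 hB1 hB2 hne, hιP1, hιP2]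
  -- polynomial bookkeeping
  have ha : a + 2 * e = μ + (a + 2 * e - μ) := (Nat.add_sub_cancel' (min_le_left _ _)).symm
  have hb : b = μ + (b - μ) := (Nat.add_sub_cancel' (min_le_right _ _)).symm
  rw [MvPolynomial.monomial_eq, MvPolynomial.monomial_eq, Finsupp.prod_add_index' (by simp) (by simp [pow_add]),
    Finsupp.prod_add_index' (by simp) (by simp [pow_add]), Finsupp.prod_single_index (by simp),
    Finsupp.prod_single_index (by simp), Finsupp.prod_single_index (by simp),
    Finsupp.prod_single_index (by simp)]
  conv_lhs => rw [ha, hb]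
  rw [pow_add, pow_add, MvPolynomial.C_1]
  ring

variable (p : ℕ) [Fact p.Prime] [CharP κ p]

/-- **The certificate.** A position `x · Π^p · E^p` admits NO decomposition `w^A · v + g^p` with `w` of
invertible linear part, `v` a unit and some `p ∤ A k` — in particular it is never terminal′ (clause 3),
nor a monomial times a unit (clause 2b).  Proof: `M · ŵ ∈ J(f)` (structure stub) is divisible by `Π^p`;
shear by `θ` and take weighted initial forms: the prime binomial `c·x^{a+2e}y² − x^b z³` would divide the
initial form of an order-one series, whose weight is at most `max wt < weight of the binomial`. [folklore] -/
theorem no_monomial_decomposition (a e b : ℕ) (U E : MvPowerSeries (Fin 3) κ) (hU : IsUnit U)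
    (w : Fin 3 → MvPowerSeries (Fin 3) κ)
    (hw0 : ∀ j, MvPowerSeries.constantCoeff (w j) = 0)
    (hdet : IsUnit (Matrix.det (Matrix.of fun i j => MvPowerSeries.coeff (Finsupp.single i 1) (w j))))
    (A : Fin 3 → ℕ) (k : Fin 3) (hk : ¬ p ∣ A k) (v g : MvPowerSeries (Fin 3) κ) (hv : IsUnit v)
    (hf : posSt p a e b U E = (Finset.prod Finset.univ fun j => w j ^ A j) * v + g ^ p) : False := by
  classical
  -- the derivations and the structure of the Jacobian ideal
  obtain ⟨D, hDc, hL, hP, -⟩ := stub_deriv p κ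
  have hdet' : IsUnit (Matrix.det (Matrix.of fun i j => MvPowerSeries.constantCoeff (D i (w j)))) := by
    have : (Matrix.of fun i j => MvPowerSeries.constantCoeff (D i (w j))) =
        Matrix.of fun i j => MvPowerSeries.coeff (Finsupp.single i 1) (w j) := by
      ext i j
      simp only [Matrix.of_apply, ← MvPowerSeries.coeff_zero_eq_constantCoeff_apply, hDc, zero_add,
        Finsupp.coe_zero, Pi.zero_apply, Nat.cast_one, one_mul]
    rw [this]; exact hdet
  have hmem := stub_structure p κ D hL hP w hw0 hdet' A k hk v g (posSt p a e b U E) hv hf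
  -- every partial derivative of the position is divisible by Π^p
  set Pst : MvPowerSeries (Fin 3) κ := PiSt a e b U with hPst
  set h : MvPowerSeries (Fin 3) κ := X 0 * E ^ p with hh
  have hfac : posSt p a e b U E = Pst ^ p * h := by simp only [posSt, hPst, hh]; ring
  have hDf : ∀ i, D i (posSt p a e b U E) = Pst ^ p * D i h := by
    intro i; rw [hfac, hL, hP, mul_zero, add_zero]
  have hsub : Ideal.span (Set.range fun i => D i (posSt p a e b U E)) ≤ Ideal.span {Pst ^ p} := by
    refine Ideal.span_le.mpr ?_
    rintro _ ⟨i, rfl⟩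
    refine Ideal.mem_span_singleton'.mpr ⟨D i h, ?_⟩
    show D i h * Pst ^ p = D i (posSt p a e b U E)
    rw [hDf i, mul_comm]
  obtain ⟨q, hq⟩ := Ideal.mem_span_singleton'.mp (hsub hmem)
  -- notation for M·ŵ
  set Mw : MvPowerSeries (Fin 3) κ := (Finset.prod Finset.univ fun j => w j ^ (A j - if p ∣ A j then 0 else 1)) *
    (Finset.prod ((Finset.univ.erase k).filter fun j => ¬ p ∣ A j) fun j => w j) with hMw
  -- the shear θ and the initial form ι
  set θ : MvPowerSeries (Fin 3) κ →ₐ[κ] MvPowerSeries (Fin 3) κ := MvPowerSeries.substAlgHom (hasSubst_up κ)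
    with hθ
  have hθap : ∀ x, θ x = MvPowerSeries.subst (shUp κ) x := fun x => MvPowerSeries.substAlgHom_apply _ x
  obtain ⟨ι, hι⟩ := exists_isInit (κ := κ) (wtS a e b) (wtS_pos a e b)
  -- each w j is non-zero with a non-zero linear coefficient
  have hwlin : ∀ j, ∃ i, MvPowerSeries.coeff (Finsupp.single i 1) (w j) ≠ 0 := by
    intro j; by_contra! hall
    apply hdet.ne_zero
    exact Matrix.det_eq_zero_of_column_eq_zero j (fun i => by simp [hall i])
  have hwne : ∀ j, w j ≠ 0 := by
    intro j hj; obtain ⟨i, hi⟩ := hwlin j; exact hi (by rw [hj]; simp)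
  -- the initial form of θ Π
  set cU : κ := MvPowerSeries.constantCoeff (θ U) with hcU
  have hcU0 : cU ≠ 0 := (MvPowerSeries.isUnit_iff_constantCoeff.mp (hU.map θ)).ne_zero
  set μ : ℕ := min (a + 2 * e) b with hμ
  set ψ : MvPolynomial (Fin 3) κ := MvPolynomial.C cU * MvPolynomial.X 0 ^ (a + 2 * e - μ) *
    MvPolynomial.X 1 ^ 2 - MvPolynomial.X 0 ^ (b - μ) * MvPolynomial.X 2 ^ 3 with hψ
  have hψprime : Prime ψ := stub_psiPrime κ cU hcU0 _ _ (by
    rcases le_total (a + 2 * e) b with hle | hle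
    · left; rw [hμ, min_eq_left hle]; simp
    · right; rw [hμ, min_eq_right hle]; simp)
  have hiPst : ι (θ Pst) = MvPolynomial.X 0 ^ μ * ψ := by
    rw [hθap, hPst, hψ, hμ, hcU, hθap]
    exact init_form_PiSt a e b U hU hι
  -- apply θ and ι to  q * Π^p = M·ŵ
  have hιq : ι (θ Mw) = (MvPolynomial.X 0 ^ μ * ψ) ^ p * ι (θ q) := by
    rw [← hq, map_mul, map_pow, hι.mul, hι.pow, hiPst, mul_comm]
  have hdvd : ψ ∣ ι (θ Mw) := by
    rw [hιq, mul_pow]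
    exact Dvd.dvd.mul_right (Dvd.dvd.mul_left (dvd_pow_self ψ (Nat.Prime.ne_zero Fact.out)) _) _
  -- ψ divides the initial form of some θ (w j)
  have hex : ∃ j, ψ ∣ ι (θ (w j)) := by
    have hsplit : ι (θ Mw) = (Finset.prod Finset.univ fun j => ι (θ (w j)) ^ (A j - if p ∣ A j then 0 else 1)) *
        Finset.prod ((Finset.univ.erase k).filter fun j => ¬ p ∣ A j) fun j => ι (θ (w j)) := by
      rw [hMw, map_mul, map_prod, map_prod, hι.mul, hι.prod, hι.prod]
      congr 1
      refine Finset.prod_congr rfl fun j _ => ?_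
      rw [map_pow, hι.pow]
    rw [hsplit] at hdvd
    rcases hψprime.dvd_or_dvd hdvd with h1 | h1
    · obtain ⟨j, -, hj⟩ := hψprime.exists_mem_finset_dvd h1
      exact ⟨j, hψprime.dvd_of_dvd_pow hj⟩
    · obtain ⟨j, -, hj⟩ := hψprime.exists_mem_finset_dvd h1
      exact ⟨j, hj⟩
  obtain ⟨j, hj⟩ := hex
  -- the contradiction on weights
  have hθw0 : θ (w j) ≠ 0 := by
    rw [hθap]; intro h0
    exact hwne j (subst_up_injective κ (by rw [h0, ← hθap, map_zero]))
  obtain ⟨Nj, hN1, -, hN3⟩ := hι.coeff (θ (w j)) hθw0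
  obtain ⟨i, hi⟩ := exists_lin_subst_up κ (hw0 j) (hwlin j)
  rw [← hθap] at hi
  have hNj : Nj ≤ wtS a e b i := by
    by_contra hlt
    exact hi (hN1 _ (by simpa [Finsupp.weight_single] using not_le.mp hlt))
  have hη0 : ι (θ (w j)) ≠ 0 := hι.ne_zero hθw0
  set dψ : ℕ := 2 * (a + 2 * e - μ) + 2 * wtS a e b 1 with hdψ
  have hdψ' : dψ = 2 * (b - μ) + 3 * wtS a e b 2 := by
    simp only [hdψ, wtS, Matrix.cons_val_one, Matrix.cons_val, hμ]
    rcases le_total (a + 2 * e) b with hle | hle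
    · rw [min_eq_left hle]; omega
    · rw [min_eq_right hle]; omega
  have hψsupp : ∀ d, MvPolynomial.coeff d ψ ≠ 0 → Finsupp.weight (wtS a e b) d = dψ := by
    intro d hd
    rw [hψ, coeff_psi] at hd
    by_cases hd1 : d = Finsupp.single 0 (a + 2 * e - μ) + Finsupp.single 1 2
    · rw [hd1, weight_eq_sum, Fin.sum_univ_three, hdψ]
      simp [wtS]; ring
    by_cases hd2 : d = Finsupp.single 0 (b - μ) + Finsupp.single 2 3
    · rw [hd2, weight_eq_sum, Fin.sum_univ_three, hdψ']
      simp [wtS]; ring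
    · rw [if_neg hd1, if_neg hd2, sub_zero] at hd; exact absurd rfl hd
  have hηsupp : ∀ d, MvPolynomial.coeff d (ι (θ (w j))) ≠ 0 → Finsupp.weight (wtS a e b) d = Nj := by
    intro d hd; rw [hN3 d] at hd; by_contra hne; rw [if_neg hne] at hd; exact hd rfl
  have hle := hι.weight_le_of_dvd hη0 hψsupp hηsupp hj
  have hbig : wtS a e b i < dψ := by
    have : wtS a e b i ≤ wtS a e b 1 := by
      obtain ⟨h0, h1, h2⟩ := wtS_val a e b
      fin_cases i
      · simp only [Fin.zero_eta, Fin.isValue]; omega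
      · simp only [Fin.mk_one, Fin.isValue]; omega
      · simp only [Fin.reduceFinMk, Fin.isValue]; omega
    have h1pos : 0 < wtS a e b 1 := wtS_pos a e b 1
    omega
  omega

end Core


end Summit.ResolutionOfSingularities.ResolutionOfSingularities.Theorems.ShadowGameWinR.Negative

end
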